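import Summits.ResolutionOfSingularities.ResolutionOfSingularities.Theorems.RadicialJungCleanModelsCcurveRebaseField
import HarnessLib

/-!
# Route `RadicialJung`, crux `CleanModels` (stmt-15917) — (C-curve) sub-line, brick S1c: closed centres over the rebasing field `k(t)`

Lead `res-B-lead-1` g6 (plan `Cruxes/CleanModels/Lines/Sketch-memo-Ccurve-plan.md` §1 S1; third quarter of `stub_Cc_rebaseD2`).  OURS · counted 0.  Nothing here proves
resolution in characteristic `p`; resolution in char `p` is NOT proved.

Setting: valuation rings `O ≤ O₁ ≠ K`, NO divisorial coarsening of `O` (hypothesis `hdiv` of the research stub :249‴: no two elements of `O` are residually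
algebraically independent over `k` for a proper coarsening), a `k`-subalgebra `B ⊆ O`, `t ∈ B` an `O₁`-unit in the maximal ideal of `O` (✓ `…CcurveCoarseCentre`).
Everything is phrased with VALUATIONS in `K` (no residue fields): «`z ≡ 0`» means `O₁.valuation z < 1`.
* `twoVar`, `twoVar_injective`, `ev_twoVar` — the dictionary `MvPolynomial (Fin 2) k ≅ k[X][Y]` (`X ↦ t`, `Y ↦` the element) and its evaluation.
* `exists_rel_of_mem` — for `a ∈ O` there is a non-zero `q ∈ k[X][Y]` with `q(t, a) ≡ 0` (from `hdiv` at the pair `(t, a)`).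
* `exists_rel_of_unit` — the same for every `O₁`-UNIT `x ∈ O₁` (if `x ∉ O`, reverse the relation of `x⁻¹ ∈ O`).
* `exists_inv_mod_of_unit` — hence for an `O₁`-unit `x` in a subring `T ⊆ O₁` containing `B` and `k⟮t⟯`, some `y ∈ T` has `x y ≡ 1`: write `q = Y^m r`,
  `r = r₀(X) + Y r′`, `r₀ ≠ 0`; `r₀(t)` is an `O₁`-unit (✓ `valuation_aeval_eq_one`) and `y := −r′(t, x) · r₀(t)⁻¹`.
* `isMaximal_subringCentre_of_rebase` — **hzd over `F = k⟮t⟯`**: the centre of `O₁` on every such `T` is MAXIMAL (the hypothesis `hzd` of ✓ `stub_cleanLU2` over the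
  rebased ground field).
-/

noncomputable section

set_option linter.dupNamespace false

open IsLocalRing Polynomial
open Literature.AlgebraicGeometry.Resolution
open Summit.ResolutionOfSingularities.ResolutionOfSingularities.Theorems.SwitchingDichotomy

namespace Summit.ResolutionOfSingularities.ResolutionOfSingularities.Theorems.RadicialJung.CleanModels.Ccurve

variable {K : Type} [Field K] {k : Type} [Field k] [Algebra k K]

/-! ## The dictionary `MvPolynomial (Fin 2) k → k[X][Y]` -/

/-- Two-variable evaluation of `q ∈ k[X][Y]` at `(t, x)`: the inner variable at `t`, the outer at `x`. [folklore] -/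
theorem ev_def (t x : K) (q : Polynomial (Polynomial k)) :
    eval₂ (aeval t : k[X] →ₐ[k] K).toRingHom x q = eval₂ (aeval t : k[X] →ₐ[k] K).toRingHom x q := rfl

/-- The `k`-algebra map `MvPolynomial (Fin 2) k → k[X][Y]`, `X₀ ↦ C X` (the `t`-slot), `X₁ ↦ Y` (the element slot), is INJECTIVE (it has the left inverse
`Y ↦ X₁`, `X ↦ X₀`). [folklore] -/
theorem twoVar_injective :
    Function.Injective (MvPolynomial.aeval ![Polynomial.C Polynomial.X, Polynomial.X] :
      MvPolynomial (Fin 2) k →ₐ[k] Polynomial (Polynomial k)) := by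
  -- a left inverse
  let ψ : Polynomial (Polynomial k) →+* MvPolynomial (Fin 2) k :=
    eval₂RingHom (eval₂RingHom MvPolynomial.C (MvPolynomial.X 0)) (MvPolynomial.X 1)
  have hψ : ∀ P : MvPolynomial (Fin 2) k, ψ (MvPolynomial.aeval ![Polynomial.C Polynomial.X, Polynomial.X] P) = P := by
    intro P
    have key : (ψ.comp (MvPolynomial.aeval ![Polynomial.C Polynomial.X, Polynomial.X] :
        MvPolynomial (Fin 2) k →ₐ[k] Polynomial (Polynomial k)).toRingHom) = RingHom.id _ := by
      apply MvPolynomial.ringHom_ext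
      · intro c
        simp [ψ]
      · intro i
        fin_cases i <;> simp [ψ]
    exact congrArg (fun f : MvPolynomial (Fin 2) k →+* MvPolynomial (Fin 2) k => f P) key
  intro P Q hPQ
  rw [← hψ P, ← hψ Q, hPQ]

/-- Evaluation through the dictionary: `(ΦP)(t, x) = P(t, x)`. [folklore] -/
theorem ev_twoVar (t x : K) (P : MvPolynomial (Fin 2) k) :
    eval₂ (aeval t : k[X] →ₐ[k] K).toRingHom x (MvPolynomial.aeval ![Polynomial.C Polynomial.X, Polynomial.X] P) =
      MvPolynomial.aeval ![t, x] P := by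
  -- both sides are `k`-algebra maps `MvPolynomial (Fin 2) k → K` agreeing on the variables
  let E : Polynomial (Polynomial k) →ₐ[k] K :=
    { eval₂RingHom (aeval t : k[X] →ₐ[k] K).toRingHom x with
      commutes' := fun c => by simp [Polynomial.algebraMap_apply] }
  have key : E.comp (MvPolynomial.aeval ![Polynomial.C Polynomial.X, Polynomial.X]) = MvPolynomial.aeval ![t, x] := by
    apply MvPolynomial.algHom_ext
    intro i
    fin_cases i <;> simp [E]
  exact congrArg (fun f : MvPolynomial (Fin 2) k →ₐ[k] K => f P) key

/-! ## Relations from «no divisorial coarsening» -/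

/-- Evaluations of `k`-polynomials at elements of a `k`-subalgebra stay in it. [folklore] -/
theorem mvPolynomial_aeval_mem (S : Subalgebra k K) {n : ℕ} (y : Fin n → K) (hy : ∀ i, y i ∈ S) (P : MvPolynomial (Fin n) k) :
    MvPolynomial.aeval y P ∈ S := by
  have h : MvPolynomial.aeval y P = S.val (MvPolynomial.aeval (fun i => (⟨y i, hy i⟩ : S)) P) := by
    rw [← AlgHom.comp_apply, MvPolynomial.comp_aeval]; rfl
  rw [h]; exact Subtype.mem _

/-- The valuation ring `O₁ ⊇ k` as a `k`-subalgebra of `K`. [folklore] -/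
theorem exists_subalgebra_eq (O₁ : ValuationSubring K) (hk : ∀ c : k, algebraMap k K c ∈ O₁) :
    ∃ S : Subalgebra k K, S.toSubring = O₁.toSubring :=
  ⟨{ O₁.toSubring with algebraMap_mem' := hk }, rfl⟩

/-- For `a ∈ O` there is a non-zero `q ∈ k[X][Y]` with `q(t, a) ≡ 0 (mod 𝔪_{O₁})` — the pair `(t, a)` is not residually independent. [folklore] -/
theorem exists_rel_of_mem (O O₁ : ValuationSubring K) (hOO₁ : O ≤ O₁) (hO₁ : O₁ ≠ ⊤) (hk : ∀ c : k, algebraMap k K c ∈ O)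
    (hdiv : ¬ (∃ (O₁ : ValuationSubring K), O ≤ O₁ ∧ O₁ ≠ ⊤ ∧ ∃ y : Fin 2 → K, (∀ i, y i ∈ O) ∧
      ∀ P : MvPolynomial (Fin 2) k, P ≠ 0 → O₁.valuation (MvPolynomial.aeval y P) = 1))
    (t : K) (htO : t ∈ O) (a : K) (haO : a ∈ O) :
    ∃ q : Polynomial (Polynomial k), q ≠ 0 ∧ O₁.valuation (eval₂ (aeval t : k[X] →ₐ[k] K).toRingHom a q) < 1 := by
  by_contra hnone
  push Not at hnone
  apply hdiv
  refine ⟨O₁, hOO₁, hO₁, ![t, a], ?_, fun P hP => ?_⟩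
  · intro i; fin_cases i
    · exact htO
    · exact haO
  · have hq0 : (MvPolynomial.aeval ![(Polynomial.C Polynomial.X : Polynomial (Polynomial k)), Polynomial.X] P :
        Polynomial (Polynomial k)) ≠ 0 := by
      intro h; exact hP (twoVar_injective (k := k) (by rw [h, map_zero]))
    obtain ⟨S, hS⟩ := exists_subalgebra_eq (k := k) O₁ (fun c => hOO₁ (hk c))
    have hmem : MvPolynomial.aeval ![t, a] P ∈ O₁ := by
      have h1 := mvPolynomial_aeval_mem S ![t, a] (by
        intro i; fin_cases i
        · show t ∈ S.toSubring; rw [hS]; exact hOO₁ htO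
        · show a ∈ S.toSubring; rw [hS]; exact hOO₁ haO) P
      have h2 : MvPolynomial.aeval ![t, a] P ∈ S.toSubring := h1
      rw [hS] at h2; exact h2
    have hle : O₁.valuation (MvPolynomial.aeval ![t, a] P) ≤ 1 := (O₁.valuation_le_one_iff _).mpr hmem
    exact le_antisymm hle (by rw [← ev_twoVar]; exact hnone _ hq0)

/-- The same for every `O₁`-UNIT `x ∈ O₁`: if `x ∉ O`, reverse the relation of `x⁻¹ ∈ O`. [folklore] -/
theorem exists_rel_of_unit (O O₁ : ValuationSubring K) (hOO₁ : O ≤ O₁) (hO₁ : O₁ ≠ ⊤) (hk : ∀ c : k, algebraMap k K c ∈ O)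
    (hdiv : ¬ (∃ (O₁ : ValuationSubring K), O ≤ O₁ ∧ O₁ ≠ ⊤ ∧ ∃ y : Fin 2 → K, (∀ i, y i ∈ O) ∧
      ∀ P : MvPolynomial (Fin 2) k, P ≠ 0 → O₁.valuation (MvPolynomial.aeval y P) = 1))
    (t : K) (htO : t ∈ O) (x : K) (hvx : O₁.valuation x = 1) :
    ∃ q : Polynomial (Polynomial k), q ≠ 0 ∧ O₁.valuation (eval₂ (aeval t : k[X] →ₐ[k] K).toRingHom x q) < 1 := by
  by_cases hxO : x ∈ O
  · exact exists_rel_of_mem O O₁ hOO₁ hO₁ hk hdiv t htO x hxO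
  · have hx0 : x ≠ 0 := ne_zero_of_valuation_eq_one hvx
    have hbO : x⁻¹ ∈ O := (O.mem_or_inv_mem x).resolve_left hxO
    obtain ⟨qb, hqb0, hqb⟩ := exists_rel_of_mem O O₁ hOO₁ hO₁ hk hdiv t htO x⁻¹ hbO
    refine ⟨qb.reverse, fun h => hqb0 (Polynomial.reverse_eq_zero.mp h), ?_⟩
    letI : Invertible x⁻¹ := invertibleOfNonzero (inv_ne_zero hx0)
    have key := eval₂_reverse_mul_pow (aeval t : k[X] →ₐ[k] K).toRingHom x⁻¹ qb
    rw [invOf_eq_inv, inv_inv] at key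
    have hvb : O₁.valuation x⁻¹ = 1 := by rw [map_inv₀, hvx, inv_one]
    have h2 : O₁.valuation (eval₂ (aeval t : k[X] →ₐ[k] K).toRingHom x qb.reverse) =
        O₁.valuation (eval₂ (aeval t : k[X] →ₐ[k] K).toRingHom x⁻¹ qb) := by
      rw [← key, map_mul, map_pow, hvb, one_pow, mul_one]
    rw [h2]; exact hqb

/-- Two-variable evaluations at elements of a `k`-subalgebra stay in it. [folklore] -/
theorem ev_mem (S : Subalgebra k K) (t x : K) (ht : t ∈ S) (hx : x ∈ S) (q : Polynomial (Polynomial k)) :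
    eval₂ (aeval t : k[X] →ₐ[k] K).toRingHom x q ∈ S := by
  induction q using Polynomial.induction_on' with
  | add p q hp hq => rw [eval₂_add]; exact S.add_mem hp hq
  | monomial n c =>
    rw [eval₂_monomial]
    refine S.mul_mem ?_ (S.pow_mem hx n)
    change aeval t c ∈ S
    exact (Algebra.adjoin_le (Set.singleton_subset_iff.mpr ht) : Algebra.adjoin k {t} ≤ S) (aeval_mem_adjoin_singleton k t)

/-- **An `O₁`-unit of `T` is invertible modulo `𝔪_{O₁} ∩ T`** when `T ⊆ O₁` is a subring containing the `k`-subalgebra `B ∋ t` (`t` an `O₁`-unit in `𝔪_O`) and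
the field `k⟮t⟯`: write the relation `q(t, x) ≡ 0` as `x^m (r₀(t) + x r′(t, x)) ≡ 0` with `r₀ ≠ 0`; then `r₀(t)` is an `O₁`-unit and `y = −r′(t, x) r₀(t)⁻¹`.
[folklore] -/
theorem exists_inv_mod_of_unit (O O₁ : ValuationSubring K) (hOO₁ : O ≤ O₁) (hO₁ : O₁ ≠ ⊤)
    (hdiv : ¬ (∃ (O₁ : ValuationSubring K), O ≤ O₁ ∧ O₁ ≠ ⊤ ∧ ∃ y : Fin 2 → K, (∀ i, y i ∈ O) ∧
      ∀ P : MvPolynomial (Fin 2) k, P ≠ 0 → O₁.valuation (MvPolynomial.aeval y P) = 1))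
    (B : Subalgebra k K) (hBO : B.toSubring ≤ O.toSubring) (t : K) (htB : t ∈ B) (hvt : O.valuation t < 1) (hv₁t : O₁.valuation t = 1)
    (T : Subring K) (hBT : B.toSubring ≤ T) (hF : ∀ z ∈ IntermediateField.adjoin k ({t} : Set K), z ∈ T)
    (x : K) (hxT : x ∈ T) (hvx : O₁.valuation x = 1) :
    ∃ y : K, y ∈ T ∧ O₁.valuation (x * y - 1) < 1 := by
  have hk : ∀ c : k, algebraMap k K c ∈ O := fun c => hBO (B.algebraMap_mem c)
  obtain ⟨q, hq0, hq⟩ := exists_rel_of_unit O O₁ hOO₁ hO₁ hk hdiv t (hBO htB) x hvx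
  set i : k[X] →+* K := (aeval t : k[X] →ₐ[k] K).toRingHom with hi
  -- `q = Y^m r`, `r(·, 0) ≠ 0`
  obtain ⟨r, hqr, hr⟩ := exists_eq_pow_rootMultiplicity_mul_and_not_dvd q hq0 0
  rw [map_zero, sub_zero] at hqr hr
  have hr0 : r.coeff 0 ≠ 0 := fun h => hr (X_dvd_iff.mpr h)
  obtain ⟨r', hr'⟩ : X ∣ r - C (r.coeff 0) := X_dvd_iff.mpr (by simp)
  have hr_eq : r = C (r.coeff 0) + X * r' := by rw [← hr']; ring
  -- evaluations
  have hvr : O₁.valuation (eval₂ i x r) < 1 := by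
    set m := q.rootMultiplicity 0 with hm
    have h1 : eval₂ i x q = x ^ m * eval₂ i x r := by
      conv_lhs => rw [hqr]
      rw [eval₂_mul, eval₂_pow, eval₂_X]
    rw [h1, map_mul, map_pow, hvx, one_pow, one_mul] at hq
    exact hq
  set u₀ : K := aeval t (r.coeff 0) with hu₀
  have hvu₀ : O₁.valuation u₀ = 1 := valuation_aeval_eq_one O O₁ hOO₁ B hBO t htB hvt hv₁t _ hr0
  have hu₀0 : u₀ ≠ 0 := ne_zero_of_valuation_eq_one hvu₀
  have hev_r : eval₂ i x r = u₀ + x * eval₂ i x r' := by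
    conv_lhs => rw [hr_eq]
    rw [eval₂_add, eval₂_C, eval₂_mul, eval₂_X, hu₀, hi]; rfl
  -- `T` as a `k`-subalgebra
  let T' : Subalgebra k K := { T with algebraMap_mem' := fun c => hBT (B.algebraMap_mem c) }
  have hr'T : eval₂ i x r' ∈ T := ev_mem T' t x (hBT htB) hxT r'
  have hu₀T : u₀⁻¹ ∈ T := by
    apply hF
    apply inv_mem
    rw [IntermediateField.mem_adjoin_simple_iff]
    exact ⟨r.coeff 0, 1, by rw [hu₀, map_one, div_one]⟩
  refine ⟨-(eval₂ i x r') * u₀⁻¹, T.mul_mem (T.neg_mem hr'T) hu₀T, ?_⟩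
  have hcalc : x * (-(eval₂ i x r') * u₀⁻¹) - 1 = -(eval₂ i x r) * u₀⁻¹ := by
    rw [hev_r]; field_simp; ring
  rw [hcalc, map_mul, Valuation.map_neg, map_inv₀, hvu₀, inv_one, mul_one]
  exact hvr

/-- **hzd over the rebasing field `k⟮t⟯`**: for `T ⊆ O₁` a subring containing `B ∋ t` and `k⟮t⟯`, the centre of `O₁` on `T` is MAXIMAL — `T ⧸ (𝔪_{O₁} ∩ T)` is a field by
`exists_inv_mod_of_unit`.  (The hypothesis `hzd` of ✓ `stub_cleanLU2` over the ground field `k⟮t⟯`.) [folklore] -/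
theorem isMaximal_subringCentre_of_rebase (O O₁ : ValuationSubring K) (hOO₁ : O ≤ O₁) (hO₁ : O₁ ≠ ⊤)
    (hdiv : ¬ (∃ (O₁ : ValuationSubring K), O ≤ O₁ ∧ O₁ ≠ ⊤ ∧ ∃ y : Fin 2 → K, (∀ i, y i ∈ O) ∧
      ∀ P : MvPolynomial (Fin 2) k, P ≠ 0 → O₁.valuation (MvPolynomial.aeval y P) = 1))
    (B : Subalgebra k K) (hBO : B.toSubring ≤ O.toSubring) (t : K) (htB : t ∈ B) (hvt : O.valuation t < 1) (hv₁t : O₁.valuation t = 1)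
    (T : Subring K) (hBT : B.toSubring ≤ T) (hT : T ≤ O₁.toSubring) (hF : ∀ z ∈ IntermediateField.adjoin k ({t} : Set K), z ∈ T) :
    (subringCentre T O₁ hT).IsMaximal := by
  set 𝔮 := subringCentre T O₁ hT with h𝔮
  apply Ideal.Quotient.maximal_of_isField
  haveI : Nontrivial (T ⧸ 𝔮) := Ideal.Quotient.nontrivial_iff.mpr (Ideal.IsPrime.ne_top inferInstance)
  refine { exists_pair_ne := exists_pair_ne _, mul_comm := mul_comm, mul_inv_cancel := ?_ }
  intro a ha
  obtain ⟨x, rfl⟩ := Ideal.Quotient.mk_surjective a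
  have hx𝔮 : x ∉ 𝔮 := fun h => ha (Ideal.Quotient.eq_zero_iff_mem.mpr h)
  have hvx : O₁.valuation (x : K) = 1 := valuation_eq_one_of_not_mem_subringCentre hT hx𝔮
  obtain ⟨y, hyT, hy⟩ := exists_inv_mod_of_unit O O₁ hOO₁ hO₁ hdiv B hBO t htB hvt hv₁t T hBT hF x x.2 hvx
  refine ⟨Ideal.Quotient.mk 𝔮 ⟨y, hyT⟩, ?_⟩
  rw [← map_mul, ← (Ideal.Quotient.mk 𝔮).map_one, Ideal.Quotient.eq, h𝔮, mem_subringCentre_iff]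
  exact hy

end Summit.ResolutionOfSingularities.ResolutionOfSingularities.Theorems.RadicialJung.CleanModels.Ccurve

end
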